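import Mathlib
import Summits.AtomisticToContinuum.HydrodynamicLimit.Theorems.InformationPercolationEngineKickFairRelEquilibriumMesoDefs
import Summits.AtomisticToContinuum.HydrodynamicLimit.Theorems.InformationPercolationEngineKickFairRelEquilibriumMesoTransferAE
import Summits.AtomisticToContinuum.HydrodynamicLimit.Theorems.InformationPercolationEngineKickFairRelEquilibriumMesoPastMeasurable
import Literature.MathematicalPhysics.KineticTheory.LocalGibbsConstEquivalence
import HarnessLib

/-!
# Vocabulary of the line `condition-the-past` for the crux `KickFairRelEquilibriumMeso`
(stmt-AtomisticToContinuum-15177; rank 2 of route `InformationPercolationEngine`)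

Definitions-only support file (`--supports stmt-AtomisticToContinuum-15177`) of the lead prover of the line
`Cruxes/KickFairRelEquilibriumMeso/Lines/condition_the_past.lean` (strategist's checked skeleton, 2026-08-17; lead c7).
It makes the line's vocabulary IMPORTABLE so that each registered stub can land in its own sorry-free Theorems
file with the registered signature verbatim. It extends the landed vocabulary of
`…KickFairRelEquilibriumMesoDefs` (`past`, `kick`, `kappa`, `cnt`, `rs`, `tN`, …; p109029) by the objects of the
card `Ideas/condition-the-past.md`: the compensated kick `kickDev = g(X) − κ`, the `LG`-conditional bias `betaLG`
(Mathlib `condExp` under the LOCAL Gibbs law given the comap σ-algebra of the typed past), its one-collision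
enrichment `betaLG2`, the time order `Precedes` of two typed pasts, and the statements the stubs prove or consume:
`SingleKickBias` (B1), `PairInnovationBias` (B2′), `CountExcessLG` (CT-a), `UnorderedPairWeight` (CT-b) — copied
byte-for-byte from the registered skeleton — plus the two intermediate statements through which the lead splits the
registered reduction `stub_reduction` into three stubs: `TruncatedFluctuation` (the `L¹(LG)` size of the
INDEX-TRUNCATED, `β`-centred, past-weighted kick sum) and `PairExpansion` (an abstract finite-family inequality:
the second moment of a sum of conditionally centred, weighted terms is bounded by the pair INNOVATIONS of the
conditional means over "ordered" pairs plus the number of "unordered" pairs — pure measure theory, pull-out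
property of the conditional expectation). Nothing is asserted here: every `def … : Prop` is a predicate a stub
proves or the glue consumes, never a hypothesis taken as a fact.

The mathematics (card; `Lines/condition-the-past.md`): `E_LG|S_h| ≤ E_LG[(ε/(N+1))Σ|β|] + E_LG|(ε/(N+1))Σ h ξ|`,
`ξ = D − β`; the second term is truncated at `A(N+1)^{1/3}` collisions per sphere (excess paid in `LG`-mean by CT-a),
then estimated in `L²(LG)`: ordered cross terms are pair innovations (B2′) by the pull-out property, unordered pairs
are counted (CT-b).
-/

noncomputable section

open MeasureTheory Set Filter Topology
open scoped ENNReal Classical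

namespace Summit.AtomisticToContinuum.HydrodynamicLimit.Theorems.KickFairRelEquilibriumMesoLine

open Literature.Analysis.FluidPDE Literature.MathematicalPhysics.KineticTheory

/-! ## Line objects -/

/-- The compensated kick `D_{i,n} = g(X_{i,n}) − κ_{i,n}` (`κ` = `kappa`, the crux's centring under the
INVARIANT law, verbatim). -/
def kickDev {σ : ℝ} {N : ℕ} (Φ : Flow σ N) (r : ℝ) (g : V3 × V3 × V3 → ℝ) (i : Fin (N + 1)) (n : ℕ)
    (z : Phase N) : ℝ :=
  g (kick Φ i n z) - kappa Φ r g i n z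

/-- **The `LG`-conditional bias** `β_{i,n} := E_{LG}[D_{i,n} | σ(P_{i,n})]`: Mathlib's conditional expectation
under the NON-equilibrium local Gibbs law of the data, given the comap σ-algebra of the typed past (no weight `h`). -/
def betaLG (σ : ℝ) (a₀ θ₀ : T3 → ℝ) (u₀ : T3 → V3) {N : ℕ} (Φ : Flow σ N) (r : ℝ)
    (g : V3 × V3 × V3 → ℝ) (i : Fin (N + 1)) (n : ℕ) : Phase N → ℝ :=
  MeasureTheory.condExp (MeasurableSpace.comap (fun z => past Φ r z i n) inferInstance)
    (localGibbsLaw σ a₀ u₀ θ₀ N Φ) (kickDev Φ r g i n)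

/-- **The one-collision-enriched `LG`-conditional bias** of the kick `(i', n')` given ITS typed past joined
with the typed past AND the compensated outcome of another collision `(i, n)`:
`β₂((i,n) → (i',n')) := E_{LG}[D_{i',n'} | σ(P_{i',n'}, P_{i,n}, D_{i,n})]`. -/
def betaLG2 (σ : ℝ) (a₀ θ₀ : T3 → ℝ) (u₀ : T3 → V3) {N : ℕ} (Φ : Flow σ N) (r : ℝ)
    (g : V3 × V3 × V3 → ℝ) (i : Fin (N + 1)) (n : ℕ) (i' : Fin (N + 1)) (n' : ℕ) : Phase N → ℝ :=
  MeasureTheory.condExp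
    (MeasurableSpace.comap (fun z => (past Φ r z i' n', past Φ r z i n, kickDev Φ r g i n z)) inferInstance)
    (localGibbsLaw σ a₀ u₀ θ₀ N Φ) (kickDev Φ r g i' n')

/-- Time ordering `(i,n) ≺ (i',n')` of two typed pasts: the collision time of the first (coordinate `.2.2.2`)
precedes BOTH photo times (flight starts, coordinates `.2.1` and `.2.2.1`) of the second. -/
def Precedes {N : ℕ} (p p' : Past N) : Prop :=
  p.2.2.2 < p'.2.1 ∧ p.2.2.2 < p'.2.2.1

/-! ## The four statements of the line (predicates; proved by the stubs, consumed by the reduction) -/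

/-- **B1 — single-kick conditional bias in Campbell-`L¹` (the NECESSARY core of the crux).** Along the cell
sequence `rs`: for continuous positive profiles, `∃ σ₀ ∀ σ < σ₀ ∀ Φ τ g δ ∃ N₀ ∀ N ≥ N₀`,
`E_{LG}[(ε/(N+1)) Σ_i Σ_{n < cnt_i} |β_{i,n}|] ≤ δ`. Necessary: take the admissible weight `h := sign β`. -/
def SingleKickBias (rs : ℕ → ℝ) : Prop :=
  ∀ (a₀ θ₀ : T3 → ℝ) (u₀ : T3 → V3), Continuous a₀ → Continuous θ₀ → Continuous u₀ →
    (∀ x, 0 < a₀ x) → (∀ x, 0 < θ₀ x) → ∃ σ₀ : ℝ, 0 < σ₀ ∧ ∀ σ : ℝ, 0 < σ → σ < σ₀ →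
    ∀ Φ : (N : ℕ) → Flow σ N, ∀ τ : ℝ, 0 < τ →
    ∀ g : V3 × V3 × V3 → ℝ, Continuous g → (∃ C : ℝ, ∀ p, |g p| ≤ C) →
    ∀ δ : ℝ, 0 < δ → ∃ N₀ : ℕ, ∀ N : ℕ, N₀ ≤ N →
    ∫⁻ z, ENNReal.ofReal (hsDiameter σ N / ((N : ℝ) + 1) *
        ∑ i : Fin (N + 1), ∑ n ∈ Finset.range (cnt (Φ N) τ z i),
          |betaLG σ a₀ θ₀ u₀ (Φ N) (rs N) g i n z|) ∂(localGibbsLaw σ a₀ u₀ θ₀ N (Φ N)) ≤ ENNReal.ofReal δ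

/-- **B2′ — pair INNOVATION of the conditional bias over time-ORDERED pairs (pair-Campbell-`L¹`).**
`E_{LG}[(ε/(N+1))² Σ_{(i,n)} Σ_{(i',n')} 1_{(i,n) ≺ (i',n')} |β₂((i,n)→(i',n')) − β_{(i',n')}|] ≤ δ` eventually:
learning the typed past and the compensated outcome of ONE earlier kick changes the `LG`-conditional bias of a
later kick by little, on pair-average (this is what the pull-out property turns the ordered cross terms of
`E_{LG}(Σ h ξ)²` into). -/
def PairInnovationBias (rs : ℕ → ℝ) : Prop :=
  ∀ (a₀ θ₀ : T3 → ℝ) (u₀ : T3 → V3), Continuous a₀ → Continuous θ₀ → Continuous u₀ →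
    (∀ x, 0 < a₀ x) → (∀ x, 0 < θ₀ x) → ∃ σ₀ : ℝ, 0 < σ₀ ∧ ∀ σ : ℝ, 0 < σ → σ < σ₀ →
    ∀ Φ : (N : ℕ) → Flow σ N, ∀ τ : ℝ, 0 < τ →
    ∀ g : V3 × V3 × V3 → ℝ, Continuous g → (∃ C : ℝ, ∀ p, |g p| ≤ C) →
    ∀ δ : ℝ, 0 < δ → ∃ N₀ : ℕ, ∀ N : ℕ, N₀ ≤ N →
    ∫⁻ z, ENNReal.ofReal ((hsDiameter σ N / ((N : ℝ) + 1)) ^ 2 *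
        ∑ i : Fin (N + 1), ∑ n ∈ Finset.range (cnt (Φ N) τ z i),
          ∑ i' : Fin (N + 1), ∑ n' ∈ Finset.range (cnt (Φ N) τ z i'),
            (if Precedes (past (Φ N) (rs N) z i n) (past (Φ N) (rs N) z i' n') then (1 : ℝ) else 0) *
              |betaLG2 σ a₀ θ₀ u₀ (Φ N) (rs N) g i n i' n' z - betaLG σ a₀ θ₀ u₀ (Φ N) (rs N) g i' n' z|)
        ∂(localGibbsLaw σ a₀ u₀ θ₀ N (Φ N)) ≤ ENNReal.ofReal δ

/-- **CT-a — the normalised EXCESS of the per-sphere collision counts over `A (N+1)^{1/3}` is small in `LG`-mean**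
(`LG`-native count input, mean form): for continuous positive profiles, `∃ σ₀ ∀ σ < σ₀ ∀ Φ τ δ ∃ A > 0 ∃ N₀ ∀ N ≥ N₀`,
`E_{LG}[(ε/(N+1)) Σ_i (cnt_i − A (N+1)^{1/3})₊] ≤ δ`. After truncation at `A(N+1)^{1/3}` collisions per sphere the
kick sum has total weight `≤ σ A`, so its square is bounded: this is what lets the reduction work in `L²(LG)` with NO
moment hypothesis on the collision count. -/
def CountExcessLG : Prop :=
  ∀ (a₀ θ₀ : T3 → ℝ) (u₀ : T3 → V3), Continuous a₀ → Continuous θ₀ → Continuous u₀ →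
    (∀ x, 0 < a₀ x) → (∀ x, 0 < θ₀ x) → ∃ σ₀ : ℝ, 0 < σ₀ ∧ ∀ σ : ℝ, 0 < σ → σ < σ₀ →
    ∀ Φ : (N : ℕ) → Flow σ N, ∀ τ : ℝ, 0 < τ →
    ∀ δ : ℝ, 0 < δ → ∃ A : ℝ, 0 < A ∧ ∃ N₀ : ℕ, ∀ N : ℕ, N₀ ≤ N →
    ∫⁻ z, ENNReal.ofReal (hsDiameter σ N / ((N : ℝ) + 1) *
        ∑ i : Fin (N + 1), max ((cnt (Φ N) τ z i : ℝ) - A * ((N : ℝ) + 1) ^ (1 / 3 : ℝ)) 0)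
      ∂(localGibbsLaw σ a₀ u₀ θ₀ N (Φ N)) ≤ ENNReal.ofReal δ

/-- **CT-b — the normalised number of UNORDERED kick pairs is small in `LG`-mean** (`LG`-native count input).
Along `rs`: `E_{LG}[(ε/(N+1))² · #{((i,n),(i',n')) : neither (i,n) ≺ (i',n') nor (i',n') ≺ (i,n)}] ≤ δ`
eventually. The unordered pairs are the diagonal, the two kick records of one collision, and the pairs whose
collision time falls inside the other's flight window. -/
def UnorderedPairWeight (rs : ℕ → ℝ) : Prop :=
  ∀ (a₀ θ₀ : T3 → ℝ) (u₀ : T3 → V3), Continuous a₀ → Continuous θ₀ → Continuous u₀ →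
    (∀ x, 0 < a₀ x) → (∀ x, 0 < θ₀ x) → ∃ σ₀ : ℝ, 0 < σ₀ ∧ ∀ σ : ℝ, 0 < σ → σ < σ₀ →
    ∀ Φ : (N : ℕ) → Flow σ N, ∀ τ : ℝ, 0 < τ →
    ∀ δ : ℝ, 0 < δ → ∃ N₀ : ℕ, ∀ N : ℕ, N₀ ≤ N →
    ∫⁻ z, ENNReal.ofReal ((hsDiameter σ N / ((N : ℝ) + 1)) ^ 2 *
        ∑ i : Fin (N + 1), ∑ n ∈ Finset.range (cnt (Φ N) τ z i),
          ∑ i' : Fin (N + 1), ∑ n' ∈ Finset.range (cnt (Φ N) τ z i'),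
            (if ¬ Precedes (past (Φ N) (rs N) z i n) (past (Φ N) (rs N) z i' n') ∧
                ¬ Precedes (past (Φ N) (rs N) z i' n') (past (Φ N) (rs N) z i n) then (1 : ℝ) else 0))
        ∂(localGibbsLaw σ a₀ u₀ θ₀ N (Φ N)) ≤ ENNReal.ofReal δ

/-! ## The two intermediate statements of the lead's reshaped reduction -/

/-- **TF — the index-truncated, `β`-centred, past-weighted kick sum is small in `L¹(LG)`.** Along `rs`: for
continuous positive profiles, `∃ σ₀ ∀ σ < σ₀ ∀ Φ τ g ∀ A > 0 ∀ δ ∃ N₀ ∀ N ≥ N₀`, uniformly over measurable weights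
`|h| ≤ 1` of the typed past,
`E_{LG} |(ε/(N+1)) Σ_i Σ_{n < cnt_i} 1_{n < A(N+1)^{1/3}} h_{i,n}(P_{i,n}) (D_{i,n} − β_{i,n})| ≤ δ`.
The reduction proves it from B2′ and CT-b (`L²` expansion, `PairExpansion`) and consumes it, with B1 and CT-a, to
reach the body of the crux. -/
def TruncatedFluctuation (rs : ℕ → ℝ) : Prop :=
  ∀ (a₀ θ₀ : T3 → ℝ) (u₀ : T3 → V3), Continuous a₀ → Continuous θ₀ → Continuous u₀ →
    (∀ x, 0 < a₀ x) → (∀ x, 0 < θ₀ x) → ∃ σ₀ : ℝ, 0 < σ₀ ∧ ∀ σ : ℝ, 0 < σ → σ < σ₀ →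
    ∀ Φ : (N : ℕ) → Flow σ N, ∀ τ : ℝ, 0 < τ →
    ∀ g : V3 × V3 × V3 → ℝ, Continuous g → (∃ C : ℝ, ∀ p, |g p| ≤ C) →
    ∀ A : ℝ, 0 < A → ∀ δ : ℝ, 0 < δ → ∃ N₀ : ℕ, ∀ N : ℕ, N₀ ≤ N →
    ∀ h : Fin (N + 1) → ℕ → Past N → ℝ, (∀ i n, Measurable (h i n)) → (∀ i n p, |h i n p| ≤ 1) →
    ∫⁻ z, ENNReal.ofReal |hsDiameter σ N / ((N : ℝ) + 1) *
        ∑ i : Fin (N + 1), ∑ n ∈ Finset.range (cnt (Φ N) τ z i),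
          (if (n : ℝ) < A * ((N : ℝ) + 1) ^ (1 / 3 : ℝ) then (1 : ℝ) else 0) *
            (h i n (past (Φ N) (rs N) z i n) *
              (kickDev (Φ N) (rs N) g i n z - betaLG σ a₀ θ₀ u₀ (Φ N) (rs N) g i n z))|
      ∂(localGibbsLaw σ a₀ u₀ θ₀ N (Φ N)) ≤ ENNReal.ofReal δ

/-- **PE — the abstract pair expansion (pure measure theory).** On a finite measure space, let `K` be a finite
index type; for each `k`, a sub-σ-algebra `m k` ("the past of `k`"), for each pair an enlarged sub-σ-algebra
`mA k l ≥ m k, m l` for which `D k` is measurable ("the past of `l` enriched by the past and the outcome of `k`");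
outcomes `D k` with `|D k| ≤ B` a.e.; weights `w k`, `m k`-measurable, dominated by the indicator of a validity event
`v k ∈ m k`; order events `o k l` ("`k` before `l`"), measurable for `mA k l` together with `o l k`. Then, with
`β k = μ[D k | m k]` and `β₂(k → l) = μ[D l | mA k l]`,
`∫ (Σ_k w_k (D_k − β_k))² dμ ≤ 4B Σ_k Σ_l ∫ 1_{v k ∩ v l ∩ o k l} |β₂(k → l) − β_l| dμ + 4B² Σ_k Σ_l μ(v k ∩ v l ∩ (o k l)ᶜ ∩ (o l k)ᶜ)`.
Proof idea: expand the square; split each pair by `1 = 1_{o k l} + (1 − 1_{o k l}) 1_{o l k} + (1 − 1_{o k l})(1 − 1_{o l k})`;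
on the first two pieces pull the bounded `mA`-measurable factor out of the conditional expectation of the other
centred outcome (`∫ Y (D − μ[D|m]) = ∫ Y (μ[D|mA] − μ[D|m])` for `m ≤ mA ∋ Y`); bound the third by `(2B)²` times the event. -/
def PairExpansion : Prop :=
  ∀ (Ω : Type) (m0 : MeasurableSpace Ω) (μ : Measure Ω) [IsFiniteMeasure μ] (K : Type) [Fintype K]
    (m : K → MeasurableSpace Ω) (mA : K → K → MeasurableSpace Ω)
    (D w : K → Ω → ℝ) (v : K → Set Ω) (o : K → K → Set Ω) (B : ℝ),
    0 ≤ B → (∀ k, m k ≤ m0) → (∀ k l, mA k l ≤ m0) → (∀ k l, m k ≤ mA k l) → (∀ k l, m l ≤ mA k l) →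
    (∀ k l, StronglyMeasurable[mA k l] (D k)) → (∀ k, ∀ᵐ x ∂μ, |D k x| ≤ B) →
    (∀ k, StronglyMeasurable[m k] (w k)) → (∀ k, MeasurableSet[m k] (v k)) →
    (∀ k x, |w k x| ≤ (v k).indicator (fun _ => (1 : ℝ)) x) →
    (∀ k l, MeasurableSet[mA k l] (o k l)) → (∀ k l, MeasurableSet[mA k l] (o l k)) →
    ∫ x, (∑ k, w k x * (D k x - (μ[D k | m k]) x)) ^ 2 ∂μ ≤
      4 * B * ∑ k, ∑ l, (∫ x, (v k ∩ v l ∩ o k l).indicator (fun _ => (1 : ℝ)) x *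
          |(μ[D l | mA k l]) x - (μ[D l | m l]) x| ∂μ) +
      4 * B ^ 2 * ∑ k, ∑ l, μ.real (v k ∩ v l ∩ (o k l)ᶜ ∩ (o l k)ᶜ)

/-! ## Sanity / plumbing: the time order is a Borel event of the pair of pasts -/

/-- **The time order `Precedes` is a measurable event of the pair of typed pasts** (two strict inequalities
between coordinate projections of `Past N × Past N`): the ordering indicator of the reduction is Borel, hence
measurable for every σ-algebra for which the two pasts are (registered sub-goal `measurableSet_precedes`).
[folklore] -/
theorem measurableSet_precedes : ∀ N : ℕ, MeasurableSet {q : Past N × Past N | Precedes q.1 q.2} := by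
  intro N
  have h1 : Measurable fun q : Past N × Past N => q.1.2.2.2 :=
    measurable_snd.comp (measurable_snd.comp (measurable_snd.comp measurable_fst))
  have h2 : Measurable fun q : Past N × Past N => q.2.2.1 :=
    measurable_fst.comp (measurable_snd.comp measurable_snd)
  have h3 : Measurable fun q : Past N × Past N => q.2.2.2.1 :=
    measurable_fst.comp (measurable_snd.comp (measurable_snd.comp measurable_snd))
  exact (measurableSet_lt h1 h2).inter (measurableSet_lt h1 h3)

/-! ## Rev 2 (lead c7, after wave 1): the `κ`-free form of TF, the pair conditional covariance B2″, the pair expansion PE″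

Wave 1 landed the whole reduction (`stub_reductionA` p143726, `stub_pairExpansion` p144672, `stub_reductionB` p146871), discharged
CT-b from CT-a (`unorderedPairWeight_of_countExcessLG`) and proved B1 necessary (`singleKickBias_of_mesoBody` p150031), so the crux body
is `B1 ∧ TF` modulo CT-a. The objects below re-type the two remaining fluctuation statements in their weakest honest forms:
`TruncatedFluctuationLG` is TF with each kick centred at ITS OWN `LG`-conditional mean (the equilibrium kernel `κ` is
`σ(P)`-measurable and cancels inside `D − β`: `kickDev_sub_betaLG_ae_eq` below — so TF is an `LG`-only law of large numbers);
`PairCondCov` (B2″, the B2′ worker's recommendation) charges an ordered pair only through the conditional covariance of the two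
centred kicks given the JOIN of their typed pasts (no `D_c`-enrichment, no Jensen step), and `PairExpansion2` (PE″) is the matching
abstract expansion (pull-out on the join; the hypothesis `StronglyMeasurable[mA k l] (D k)` of PE is dropped).
-/

/-- The kick centred at its own `LG`-conditional mean: `g(X_{i,n}) − E_{LG}[g(X_{i,n}) | σ(P_{i,n})]` (Mathlib `condExp` under the
local Gibbs law given the comap σ-algebra of the typed past; no reference to the invariant law). -/
def centredKickLG (σ : ℝ) (a₀ θ₀ : T3 → ℝ) (u₀ : T3 → V3) {N : ℕ} (Φ : Flow σ N) (r : ℝ)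
    (g : V3 × V3 × V3 → ℝ) (i : Fin (N + 1)) (n : ℕ) (z : Phase N) : ℝ :=
  g (kick Φ i n z) -
    MeasureTheory.condExp (MeasurableSpace.comap (fun z => past Φ r z i n) inferInstance)
      (localGibbsLaw σ a₀ u₀ θ₀ N Φ) (fun z => g (kick Φ i n z)) z

/-- **TF in `LG`-only form** (`TruncatedFluctuation` with `D − β` replaced by `centredKickLG`; the two agree `LG`-a.e. by
`kickDev_sub_betaLG_ae_eq`): along `rs`, for continuous positive profiles, `∃ σ₀ ∀ σ < σ₀ ∀ Φ τ g ∀ A > 0 ∀ δ ∃ N₀ ∀ N ≥ N₀`, uniformly over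
measurable weights `|h| ≤ 1` of the typed past,
`E_{LG} |(ε/(N+1)) Σ_i Σ_{n<cnt_i} 1_{n < A(N+1)^{1/3}} h_{i,n}(P_{i,n}) (g(X_{i,n}) − E_{LG}[g(X_{i,n}) | σ(P_{i,n})])| ≤ δ`. -/
def TruncatedFluctuationLG (rs : ℕ → ℝ) : Prop :=
  ∀ (a₀ θ₀ : T3 → ℝ) (u₀ : T3 → V3), Continuous a₀ → Continuous θ₀ → Continuous u₀ →
    (∀ x, 0 < a₀ x) → (∀ x, 0 < θ₀ x) → ∃ σ₀ : ℝ, 0 < σ₀ ∧ ∀ σ : ℝ, 0 < σ → σ < σ₀ →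
    ∀ Φ : (N : ℕ) → Flow σ N, ∀ τ : ℝ, 0 < τ →
    ∀ g : V3 × V3 × V3 → ℝ, Continuous g → (∃ C : ℝ, ∀ p, |g p| ≤ C) →
    ∀ A : ℝ, 0 < A → ∀ δ : ℝ, 0 < δ → ∃ N₀ : ℕ, ∀ N : ℕ, N₀ ≤ N →
    ∀ h : Fin (N + 1) → ℕ → Past N → ℝ, (∀ i n, Measurable (h i n)) → (∀ i n p, |h i n p| ≤ 1) →
    ∫⁻ z, ENNReal.ofReal |hsDiameter σ N / ((N : ℝ) + 1) *
        ∑ i : Fin (N + 1), ∑ n ∈ Finset.range (cnt (Φ N) τ z i),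
          (if (n : ℝ) < A * ((N : ℝ) + 1) ^ (1 / 3 : ℝ) then (1 : ℝ) else 0) *
            (h i n (past (Φ N) (rs N) z i n) * centredKickLG σ a₀ θ₀ u₀ (Φ N) (rs N) g i n z)|
      ∂(localGibbsLaw σ a₀ u₀ θ₀ N (Φ N)) ≤ ENNReal.ofReal δ

/-- The `LG`-conditional covariance of the two centred kicks of an ordered pair given the JOIN of their typed pasts:
`Γ((i,n),(i',n')) := E_{LG}[(D_{i,n} − β_{i,n})(D_{i',n'} − β_{i',n'}) | σ(P_{i,n}, P_{i',n'})]`. -/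
def pairCondCovLG (σ : ℝ) (a₀ θ₀ : T3 → ℝ) (u₀ : T3 → V3) {N : ℕ} (Φ : Flow σ N) (r : ℝ)
    (g : V3 × V3 × V3 → ℝ) (i : Fin (N + 1)) (n : ℕ) (i' : Fin (N + 1)) (n' : ℕ) : Phase N → ℝ :=
  MeasureTheory.condExp
    (MeasurableSpace.comap (fun z => (past Φ r z i n, past Φ r z i' n')) inferInstance)
    (localGibbsLaw σ a₀ u₀ θ₀ N Φ)
    (fun z => (kickDev Φ r g i n z - betaLG σ a₀ θ₀ u₀ Φ r g i n z) *
      (kickDev Φ r g i' n' z - betaLG σ a₀ θ₀ u₀ Φ r g i' n' z))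

/-- **B2″ — pair conditional COVARIANCE over time-ORDERED pairs (pair-Campbell-`L¹`; the B2′ worker's recommended typing).**
`E_{LG}[(ε/(N+1))² Σ_{(i,n)} Σ_{(i',n')} 1_{(i,n) ≺ (i',n')} |Γ((i,n),(i',n'))|] ≤ δ` eventually: two time-ordered kicks, each centred at
its own `LG`-conditional mean, are conditionally uncorrelated given the join of their typed pasts, on pair-average. Implied by B2′
(tower property); with `PairExpansion2` and CT-a it implies TF. -/
def PairCondCov (rs : ℕ → ℝ) : Prop :=
  ∀ (a₀ θ₀ : T3 → ℝ) (u₀ : T3 → V3), Continuous a₀ → Continuous θ₀ → Continuous u₀ →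
    (∀ x, 0 < a₀ x) → (∀ x, 0 < θ₀ x) → ∃ σ₀ : ℝ, 0 < σ₀ ∧ ∀ σ : ℝ, 0 < σ → σ < σ₀ →
    ∀ Φ : (N : ℕ) → Flow σ N, ∀ τ : ℝ, 0 < τ →
    ∀ g : V3 × V3 × V3 → ℝ, Continuous g → (∃ C : ℝ, ∀ p, |g p| ≤ C) →
    ∀ δ : ℝ, 0 < δ → ∃ N₀ : ℕ, ∀ N : ℕ, N₀ ≤ N →
    ∫⁻ z, ENNReal.ofReal ((hsDiameter σ N / ((N : ℝ) + 1)) ^ 2 *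
        ∑ i : Fin (N + 1), ∑ n ∈ Finset.range (cnt (Φ N) τ z i),
          ∑ i' : Fin (N + 1), ∑ n' ∈ Finset.range (cnt (Φ N) τ z i'),
            (if Precedes (past (Φ N) (rs N) z i n) (past (Φ N) (rs N) z i' n') then (1 : ℝ) else 0) *
              |pairCondCovLG σ a₀ θ₀ u₀ (Φ N) (rs N) g i n i' n' z|)
        ∂(localGibbsLaw σ a₀ u₀ θ₀ N (Φ N)) ≤ ENNReal.ofReal δ

/-- **PE″ — the abstract pair expansion with the pull-out on the JOIN (pure measure theory).** As `PairExpansion`, but the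
enlarged σ-algebra `mA k l` need only contain `m k`, `m l` and the two order events (not the outcome `D k`), and an ordered pair is
charged through `|μ[(D k − μ[D k|m k])(D l − μ[D l|m l]) | mA k l]|` (no bound `B` in front): expanding the square, on the two ordered
pieces the bounded `mA k l`-measurable factor `w k · w l · 1_{o}` is pulled out of the conditional expectation of the PRODUCT of the
two centred outcomes; the unordered piece is bounded by `(2B)²` times its event as before. -/
def PairExpansion2 : Prop :=
  ∀ (Ω : Type) (m0 : MeasurableSpace Ω) (μ : Measure Ω) [IsFiniteMeasure μ] (K : Type) [Fintype K]
    (m : K → MeasurableSpace Ω) (mA : K → K → MeasurableSpace Ω)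
    (D w : K → Ω → ℝ) (v : K → Set Ω) (o : K → K → Set Ω) (B : ℝ),
    0 ≤ B → (∀ k, m k ≤ m0) → (∀ k l, mA k l ≤ m0) → (∀ k l, m k ≤ mA k l) → (∀ k l, m l ≤ mA k l) →
    (∀ k, Integrable (D k) μ) → (∀ k, ∀ᵐ x ∂μ, |D k x| ≤ B) →
    (∀ k, StronglyMeasurable[m k] (w k)) → (∀ k, MeasurableSet[m k] (v k)) →
    (∀ k x, |w k x| ≤ (v k).indicator (fun _ => (1 : ℝ)) x) →
    (∀ k l, MeasurableSet[mA k l] (o k l)) → (∀ k l, MeasurableSet[mA k l] (o l k)) →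
    ∫ x, (∑ k, w k x * (D k x - (μ[D k | m k]) x)) ^ 2 ∂μ ≤
      2 * ∑ k, ∑ l, (∫ x, (v k ∩ v l ∩ o k l).indicator (fun _ => (1 : ℝ)) x *
          |(μ[(fun x => (D k x - (μ[D k | m k]) x) * (D l x - (μ[D l | m l]) x)) | mA k l]) x| ∂μ) +
      4 * B ^ 2 * ∑ k, ∑ l, μ.real (v k ∩ v l ∩ (o k l)ᶜ ∩ (o l k)ᶜ)

/-! ## The equilibrium kernel cancels inside the centred kick -/

/-- **`D − β = g(X) − E_{LG}[g(X) | σ(P)]` almost surely** (registered sub-goal `kickDev_sub_betaLG_ae_eq`): for continuous positive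
profiles and `σ ≤ 1/2` (so that the local Gibbs law is a probability measure and is absolutely continuous w.r.t. the invariant law),
every flow, mesh, bounded continuous `g`, sphere and index, `LG`-a.e.
`kickDev − betaLG = centredKickLG`: the centring `κ = E_G[g(X) | σ(P)]` is `σ(P)`-measurable and `LG`-integrable, hence its own
`LG`-conditional expectation, and it cancels. So TF (`TruncatedFluctuation`) is an `LG`-ONLY statement. [folklore] -/
theorem kickDev_sub_betaLG_ae_eq : ∀ (σ : ℝ) (N : ℕ) (a₀ θ₀ : T3 → ℝ) (u₀ : T3 → V3),
    Continuous a₀ → Continuous θ₀ → Continuous u₀ → (∀ x, 0 < a₀ x) → (∀ x, 0 < θ₀ x) → σ ≤ 1 / 2 →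
    ∀ (Φ : Flow σ N) (r : ℝ) (g : V3 × V3 × V3 → ℝ), Continuous g → (∃ C : ℝ, ∀ p, |g p| ≤ C) →
    ∀ (i : Fin (N + 1)) (n : ℕ),
    ∀ᵐ z ∂(localGibbsLaw σ a₀ u₀ θ₀ N Φ),
      kickDev Φ r g i n z - betaLG σ a₀ θ₀ u₀ Φ r g i n z = centredKickLG σ a₀ θ₀ u₀ Φ r g i n z := by
  intro σ N a₀ θ₀ u₀ ha hθ hu ha0 hθ0 hσ2 Φ r g hg hgb i n
  obtain ⟨C, hC⟩ := hgb
  haveI : IsProbabilityMeasure (localGibbsLaw σ a₀ u₀ θ₀ N Φ) :=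
    isProbabilityMeasure_localGibbsLaw ha hθ hu ha0 hθ0 hσ2 N Φ
  -- the comap σ-algebra of the past is a sub-σ-algebra of the Borel one (NOT named: a local `MeasurableSpace` would become an instance)
  have hm : MeasurableSpace.comap (fun z => past Φ r z i n) inferInstance ≤ (inferInstance : MeasurableSpace (Phase N)) :=
    (measurable_past Φ r i n).comap_le
  -- the two ingredients: `G := g ∘ kick` (bounded, Borel) and `κ` (past-measurable, bounded a.e.)
  have hGm : Measurable fun z => g (kick Φ i n z) := hg.measurable.comp (measurable_kick Φ i n)
  have hGi : Integrable (fun z => g (kick Φ i n z)) (localGibbsLaw σ a₀ u₀ θ₀ N Φ) :=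
    Integrable.of_bound hGm.aestronglyMeasurable C (Eventually.of_forall fun z => by
      simpa [Real.norm_eq_abs] using hC (kick Φ i n z))
  have hκsm : StronglyMeasurable[MeasurableSpace.comap (fun z => past Φ r z i n) inferInstance] (kappa Φ r g i n) := by
    unfold kappa
    exact stronglyMeasurable_condExp
  have hac : localGibbsLaw σ a₀ u₀ θ₀ N Φ ≪ localGibbsLaw σ (fun _ => 1) (fun _ => 0) (fun _ => 1) N Φ :=
    localGibbsLaw_absolutelyContinuous_localGibbsLaw continuous_const continuous_const continuous_const
      (fun _ => one_pos) (fun _ => one_pos) a₀ u₀ θ₀ hσ2 N Φ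
  have hκb : ∀ᵐ z ∂(localGibbsLaw σ a₀ u₀ θ₀ N Φ), |kappa Φ r g i n z| ≤ C := hac.ae_le (ae_abs_kappa_le Φ r hC i n)
  have hκi : Integrable (kappa Φ r g i n) (localGibbsLaw σ a₀ u₀ θ₀ N Φ) :=
    Integrable.of_bound ((hκsm.mono hm).aestronglyMeasurable) C (hκb.mono fun z hz => by
      simpa [Real.norm_eq_abs] using hz)
  -- `β = LG[G − κ | m] = LG[G | m] − κ` a.e.
  have h1 : (localGibbsLaw σ a₀ u₀ θ₀ N Φ)[kickDev Φ r g i n | MeasurableSpace.comap (fun z => past Φ r z i n) inferInstance]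
      =ᵐ[localGibbsLaw σ a₀ u₀ θ₀ N Φ]
      (localGibbsLaw σ a₀ u₀ θ₀ N Φ)[(fun z => g (kick Φ i n z)) | MeasurableSpace.comap (fun z => past Φ r z i n) inferInstance] -
        (localGibbsLaw σ a₀ u₀ θ₀ N Φ)[kappa Φ r g i n | MeasurableSpace.comap (fun z => past Φ r z i n) inferInstance] := by
    have : kickDev Φ r g i n = (fun z => g (kick Φ i n z)) - kappa Φ r g i n := rfl
    rw [this]
    exact condExp_sub hGi hκi _
  have h2 : (localGibbsLaw σ a₀ u₀ θ₀ N Φ)[kappa Φ r g i n | MeasurableSpace.comap (fun z => past Φ r z i n) inferInstance] =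
      kappa Φ r g i n := condExp_of_stronglyMeasurable hm hκsm hκi
  filter_upwards [h1] with z hz
  have hz' : betaLG σ a₀ θ₀ u₀ Φ r g i n z =
      ((localGibbsLaw σ a₀ u₀ θ₀ N Φ)[(fun z => g (kick Φ i n z)) |
          MeasurableSpace.comap (fun z => past Φ r z i n) inferInstance]) z - kappa Φ r g i n z := by
    have := hz
    rw [h2] at this
    exact this
  unfold centredKickLG kickDev
  rw [hz']
  ring

end Summit.AtomisticToContinuum.HydrodynamicLimit.Theorems.KickFairRelEquilibriumMesoLine

end
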